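import Summits.QuantumAdvantage.AdviceFreeQNC0.MassInequalityRegimes
import HarnessLib

/-!
# Cell qa-qnc0 (rung F-Q1, density axis, crux of record `TensorMultOneAt`): FRACTIONAL INSIDE RE-DECODING —
# THE CERTIFICATE LEMMA at level 2 and at every level (planner qa-qnc0-p1 gen 14, Sketch14 §Cert, ask P19)

Planner qa-qnc0-p1 ROUND-13 §2 (`HOME/qa-qnc0-p1/ROUND-13.md`, `Sketch14.lean` §Cert): all four proved regimes
of the mass inequality (light rows, near-outside, pair domination, one-word) are instances of ONE lemma.
Fix codewords `R u` for the OUTSIDE rows; if the INSIDE rows admit probability weights `ν z` on the row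
code such that EVERY COLUMN passes the column test against the corresponding column of `R`
(`FracCert` / `FracCertK`), then `Σ_{z ∈ Z} dist(D z) ≤ Σ_{u ∉ Z} pdist(D u, R u)` for EVERY column-codeword
matrix `D`.  With `R u` = nearest decodings this is the mass inequality.

Statements VERBATIM from Sketch14 §Cert: `FracCert`, `CertAll`, `MIOfCert`, `FracCertK`, `CertAllK`,
`MIKOfCert`, `CertFifteen`, `massIneqAll_of_cert`.  PROVED here:

* **`miOfCert : ∀ m, MIOfCert m`** and **`mikOfCert : ∀ m, MIKOfCert m`** — both from one generic core
  `FracDecode.sum_in_le_sum_out` (any row code `S` containing `0`): pick nearest decodings `R u`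
  (`exists_eq_distTo`), take `ν` from the certificate; inside, `dist(D z) ≤ Σ_Q ν z Q · pdist(D z, Q)`
  (convexity of `distTo_le`); write `pdist` as a sum over contexts, swap the sums, apply the column test
  at the codeword column `X = D(·)(v)`, and double-count `Σ_v #{u ∉ Z : D u v ≠ R u v} = Σ_{u∉Z} pdist(D u, R u)`.
* hence `massIneqAll_fifteen_of_certFifteen : CertFifteen → MassIneqAll 15` (the dual conjecture of
  record implies MI at every level, kernel-checked chain).

The cell's lemma (not in print).  WHAT THIS IS NOT: `CertAll`/`CertAllK` at m = 14, 15 (`CertFifteen`) are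
CONJECTURES; nothing on α; separation NOT moved.
-/

noncomputable section

namespace Summit.QuantumAdvantage.AdviceFreeQNC0

open Finset
open Literature.Computability.MetaComplexity Literature.Computability.MetaComplexity.Smolensky

namespace MassInequality

/-! ### Sketch14 §Cert — statements VERBATIM -/
section Cert

/-- A FRACTIONAL INSIDE RE-DECODING CERTIFICATE for the outside row pattern `R` (level 2, row code `C_m`):
weights `ν z Q ≥ 0` on codewords `Q` (total `1` for each inside row `z`) such that for every column `v` and every
column hypothesis `X ∈ C_m`:  `Σ_{z∈Z} P_{Q∼ν z}(Q v ≠ X z) ≤ #{u ∉ Z : X u ≠ R u v}`.  (Sketch14, verbatim.) -/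
def FracCert (m : ℕ) (K0 : (Fin m → Bool) → Bool) (R : (Fin m → Bool) → (Fin m → Bool) → Bool)
    (ν : (Fin m → Bool) → ((Fin m → Bool) → Bool) → ℚ) : Prop :=
  (∀ z Q, 0 ≤ ν z Q) ∧ (∀ z Q, ν z Q ≠ 0 → IsElim1 m Q) ∧
  (∀ z, K0 z = false → ∑ Q, ν z Q = 1) ∧
  ∀ v X, IsElim1 m X →
    (∑ z ∈ univ.filter (fun z : Fin m → Bool => K0 z = false), ∑ Q, ν z Q * (if Q v = X z then (0 : ℚ) else 1)) ≤
      ((univ.filter fun u : Fin m → Bool => K0 u = true ∧ X u ≠ R u v).card : ℚ)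

/-- **CERT(m) at `K0`**: every outside row-codeword pattern admits a fractional inside re-decoding certificate.
(Sketch14, verbatim; CONJECTURE at m = 14, 15.) -/
def CertAll (m : ℕ) (K0 : (Fin m → Bool) → Bool) : Prop :=
  ∀ R : (Fin m → Bool) → (Fin m → Bool) → Bool, (∀ u, K0 u = true → IsElim1 m (R u)) → ∃ ν, FracCert m K0 R ν

/-- **THE CERTIFICATE LEMMA** (level 2): `CertAll m K0 → MassIneqAt m K0`.  (Sketch14, verbatim; proved below.) -/
def MIOfCert (m : ℕ) : Prop := ∀ K0 : (Fin m → Bool) → Bool, CertAll m K0 → MassIneqAt m K0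

/-- Level-`(k+1)` certificate: rows are decoded into the `k`-block SUM CODE `S_k = SumCodeWin (m*k) k 1`
(columns indexed by `k`-block contexts; the column code is still `C_m`).  (Sketch14, verbatim.) -/
def FracCertK (m k : ℕ) (K0 : (Fin m → Bool) → Bool) (R : (Fin m → Bool) → (Fin (m * k) → Bool) → Bool)
    (ν : (Fin m → Bool) → ((Fin (m * k) → Bool) → Bool) → ℚ) : Prop :=
  (∀ z Q, 0 ≤ ν z Q) ∧ (∀ z Q, ν z Q ≠ 0 → SumCodeWin (m * k) k 1 Q) ∧
  (∀ z, K0 z = false → ∑ Q, ν z Q = 1) ∧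
  ∀ v X, IsElim1 m X →
    (∑ z ∈ univ.filter (fun z : Fin m → Bool => K0 z = false), ∑ Q, ν z Q * (if Q v = X z then (0 : ℚ) else 1)) ≤
      ((univ.filter fun u : Fin m → Bool => K0 u = true ∧ X u ≠ R u v).card : ℚ)

/-- CERT at level `k+1`.  (Sketch14, verbatim.) -/
def CertAllK (m k : ℕ) (K0 : (Fin m → Bool) → Bool) : Prop :=
  ∀ R : (Fin m → Bool) → (Fin (m * k) → Bool) → Bool, (∀ u, K0 u = true → SumCodeWin (m * k) k 1 (R u)) →
    ∃ ν, FracCertK m k K0 R ν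

/-- The certificate lemma at every level.  (Sketch14, verbatim; proved below.) -/
def MIKOfCert (m : ℕ) : Prop := ∀ K0 : (Fin m → Bool) → Bool, ∀ k, 0 < k → CertAllK m k K0 → MassIneqK m k K0

/-- CONJECTURE OF RECORD, DUAL FORM: certificates at the symmetric optimum of `C_15` at every level.
(Sketch14, verbatim; OPEN.) -/
def CertFifteen : Prop := ∀ K0 : (Fin 15 → Bool) → Bool, IsOpt1 15 K0 → IsSymPat K0 → ∀ k, 0 < k → CertAllK 15 k K0

/-- The dual chain (pure logic).  (Sketch14, verbatim.) -/
theorem massIneqAll_of_cert (h : MIKOfCert 15) (hc : CertFifteen) : MassIneqAll 15 :=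
  fun K0 hK hs k hk => h K0 k hk (hc K0 hK hs k hk)

end Cert

end MassInequality

open MassInequality

/-! ### The generic core: any row code `S ∋ 0` on any context cube -/

namespace FracDecode

variable {m n : ℕ}

/-- `pdist` as a rational sum of mismatch indicators over the contexts. -/
theorem pdist_eq_sum (a Q : (Fin n → Bool) → Bool) :
    (pdist a Q : ℚ) = ∑ v : Fin n → Bool, (if Q v = a v then (0 : ℚ) else 1) := by
  unfold pdist
  rw [Finset.card_filter, Nat.cast_sum]
  refine sum_congr rfl fun v _ => ?_
  by_cases h : a v = Q v
  · rw [if_neg (by rw [h]; exact fun hne => hne rfl), if_pos h.symm]; simp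
  · rw [if_pos h, if_neg (fun h' => h h'.symm)]; simp

/-- Double counting of the outside mismatches: by contexts = by rows. -/
theorem sum_card_out_eq (K0 : (Fin m → Bool) → Bool) (D R : (Fin m → Bool) → (Fin n → Bool) → Bool) :
    ∑ v : Fin n → Bool, ((univ.filter fun u : Fin m → Bool => K0 u = true ∧ D u v ≠ R u v).card : ℚ) =
      ∑ u ∈ univ.filter (fun u : Fin m → Bool => K0 u = true), (pdist (D u) (R u) : ℚ) := by
  classical
  have hcol : ∀ v : Fin n → Bool, ((univ.filter fun u : Fin m → Bool => K0 u = true ∧ D u v ≠ R u v).card : ℚ) =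
      ∑ u ∈ univ.filter (fun u : Fin m → Bool => K0 u = true), (if D u v ≠ R u v then (1 : ℚ) else 0) := by
    intro v
    rw [Finset.sum_filter, Finset.card_filter, Nat.cast_sum]
    refine sum_congr rfl fun u _ => ?_
    by_cases h1 : K0 u = true <;> by_cases h2 : D u v ≠ R u v <;> simp [h1, h2]
  have hrow : ∀ u : Fin m → Bool, (pdist (D u) (R u) : ℚ) =
      ∑ v : Fin n → Bool, (if D u v ≠ R u v then (1 : ℚ) else 0) := by
    intro u; unfold pdist; rw [Finset.card_filter, Nat.cast_sum]
    refine sum_congr rfl fun v _ => ?_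
    split_ifs <;> simp
  simp_rw [hcol, hrow]
  exact Finset.sum_comm

/-- **The core of the certificate lemma.**  For a row code `S ∋ 0` on the context cube `{0,1}^n`: if for every
outside decoding `R` into `S` there is a certificate `ν` (nonnegative weights on `S`, total `1` on each inside
row, passing the column test against `R` at every codeword column), then for every matrix `D` with codeword
columns `Σ_{z ∈ Z} d(D z, S) ≤ Σ_{u ∉ Z} d(D u, S)`. -/
theorem sum_in_le_sum_out (S : ((Fin n → Bool) → Bool) → Prop) (hS0 : S (fun _ => false))
    (K0 : (Fin m → Bool) → Bool) (D : (Fin m → Bool) → (Fin n → Bool) → Bool)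
    (hcols : ∀ v, IsElim1 m (fun u => D u v))
    (hcert : ∀ R : (Fin m → Bool) → (Fin n → Bool) → Bool, (∀ u, K0 u = true → S (R u)) →
      ∃ ν : (Fin m → Bool) → ((Fin n → Bool) → Bool) → ℚ,
        (∀ z Q, 0 ≤ ν z Q) ∧ (∀ z Q, ν z Q ≠ 0 → S Q) ∧ (∀ z, K0 z = false → ∑ Q, ν z Q = 1) ∧
        ∀ v X, IsElim1 m X →
          (∑ z ∈ univ.filter (fun z : Fin m → Bool => K0 z = false),
              ∑ Q, ν z Q * (if Q v = X z then (0 : ℚ) else 1)) ≤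
            ((univ.filter fun u : Fin m → Bool => K0 u = true ∧ X u ≠ R u v).card : ℚ)) :
    ∑ u ∈ univ.filter (fun u : Fin m → Bool => K0 u = false), distTo S (D u) ≤
      ∑ u ∈ univ.filter (fun u : Fin m → Bool => K0 u = true), distTo S (D u) := by
  classical
  -- nearest decodings of the outside rows (and of all rows, harmlessly)
  have hR : ∀ u : Fin m → Bool, ∃ Q, S Q ∧ pdist (D u) Q = distTo S (D u) :=
    fun u => exists_eq_distTo ⟨_, hS0⟩ (D u)
  choose R hRS hRd using hR
  obtain ⟨ν, hν0, hνS, hν1, htest⟩ := hcert R fun u _ => hRS u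
  -- inside rows: convexity
  have hin : ∀ z, K0 z = false → (distTo S (D z) : ℚ) ≤
      ∑ Q, ν z Q * ∑ v : Fin n → Bool, (if Q v = D z v then (0 : ℚ) else 1) := by
    intro z hz
    calc (distTo S (D z) : ℚ) = ∑ Q, ν z Q * (distTo S (D z) : ℚ) := by
          rw [← sum_mul, hν1 z hz, one_mul]
      _ ≤ ∑ Q, ν z Q * ∑ v : Fin n → Bool, (if Q v = D z v then (0 : ℚ) else 1) := by
          refine sum_le_sum fun Q _ => ?_
          by_cases hQ : ν z Q = 0
          · rw [hQ, zero_mul, zero_mul]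
          · rw [← pdist_eq_sum]
            exact mul_le_mul_of_nonneg_left (by exact_mod_cast distTo_le (hνS z Q hQ)) (hν0 z Q)
  -- sum the inside bound, swap, apply the column test, double count
  have key : (∑ z ∈ univ.filter (fun z : Fin m → Bool => K0 z = false), (distTo S (D z) : ℚ)) ≤
      ∑ u ∈ univ.filter (fun u : Fin m → Bool => K0 u = true), (distTo S (D u) : ℚ) := by
    calc (∑ z ∈ univ.filter (fun z : Fin m → Bool => K0 z = false), (distTo S (D z) : ℚ))
        ≤ ∑ z ∈ univ.filter (fun z : Fin m → Bool => K0 z = false),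
            ∑ Q, ν z Q * ∑ v : Fin n → Bool, (if Q v = D z v then (0 : ℚ) else 1) :=
          sum_le_sum fun z hz => hin z (mem_filter.1 hz).2
      _ = ∑ v : Fin n → Bool, ∑ z ∈ univ.filter (fun z : Fin m → Bool => K0 z = false),
            ∑ Q, ν z Q * (if Q v = D z v then (0 : ℚ) else 1) := by
          have h1 : ∀ z : Fin m → Bool,
              (∑ Q, ν z Q * ∑ v : Fin n → Bool, (if Q v = D z v then (0 : ℚ) else 1)) =
                ∑ v : Fin n → Bool, ∑ Q, ν z Q * (if Q v = D z v then (0 : ℚ) else 1) := fun z => by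
            simp_rw [mul_sum]
            exact Finset.sum_comm
          simp_rw [h1]
          exact Finset.sum_comm
      _ ≤ ∑ v : Fin n → Bool, ((univ.filter fun u : Fin m → Bool => K0 u = true ∧ D u v ≠ R u v).card : ℚ) :=
          sum_le_sum fun v _ => htest v (fun u => D u v) (hcols v)
      _ = ∑ u ∈ univ.filter (fun u : Fin m → Bool => K0 u = true), (pdist (D u) (R u) : ℚ) :=
          sum_card_out_eq K0 D R
      _ = ∑ u ∈ univ.filter (fun u : Fin m → Bool => K0 u = true), (distTo S (D u) : ℚ) :=
          sum_congr rfl fun u _ => by rw [hRd u]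
  exact_mod_cast key

end FracDecode

open FracDecode

/-- **`MIKOfCert m` for every `m` — PROVED**: the certificate lemma at every level. -/
theorem mikOfCert (m : ℕ) : MIKOfCert m := by
  intro K0 k _ hcert D hcols
  unfold bracketK
  have h := sum_in_le_sum_out (SumCodeWin (m * k) k 1) (sumCode_false m k) K0 D hcols
    (fun R hR => by
      obtain ⟨ν, h⟩ := hcert R hR
      exact ⟨ν, h⟩)
  have h' : ((∑ u ∈ univ.filter (fun u : Fin m → Bool => K0 u = false),
      distTo (SumCodeWin (m * k) k 1) (D u) : ℕ) : ℤ) ≤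
      ((∑ u ∈ univ.filter (fun u : Fin m → Bool => K0 u = true),
        distTo (SumCodeWin (m * k) k 1) (D u) : ℕ) : ℤ) := by exact_mod_cast h
  push_cast at h'
  linarith

/-- **`MIOfCert m` for every `m` — PROVED**: the certificate lemma at level 2 (`distC = distTo (IsElim1 m)`). -/
theorem miOfCert (m : ℕ) : MIOfCert m := by
  intro K0 hcert D hcols
  unfold bracket
  have h := sum_in_le_sum_out (IsElim1 m) (isElim1_false m) K0 D hcols
    (fun R hR => by
      obtain ⟨ν, h⟩ := hcert R hR
      exact ⟨ν, h⟩)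
  have h' : ((∑ u ∈ univ.filter (fun u : Fin m → Bool => K0 u = false), distTo (IsElim1 m) (D u) : ℕ) : ℤ) ≤
      ((∑ u ∈ univ.filter (fun u : Fin m → Bool => K0 u = true), distTo (IsElim1 m) (D u) : ℕ) : ℤ) := by
    exact_mod_cast h
  push_cast at h'
  have e : ∀ u, distC m (D u) = distTo (IsElim1 m) (D u) := fun u => rfl
  simp only [e]
  linarith

/-- The dual conjecture of record implies MI at `m = 15` at every level (kernel chain). -/
theorem massIneqAll_fifteen_of_certFifteen (hc : CertFifteen) : MassIneqAll 15 :=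
  massIneqAll_of_cert (mikOfCert 15) hc

end Summit.QuantumAdvantage.AdviceFreeQNC0
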